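import Summits.Ventures.PercRepro.ProfilePointedCircuitClassesStarNineSplitA

/-!
# PercRepro — THE TWO-PART SPLIT OF THE DEFECT BOUND, PART B: THE DOUBLE COUNT `#tOneOnly ≤ #fIndep`
(p5, gen 58; `proofs/P5-GM1.md` §86)

With the classes of part A: every second-kind `e`-defect `τ` has AT LEAST TWO partners `τ' = (X − τ) − z` among the
`f`-defects with `τ' + e` independent and `τ' ∩ τ = ∅` (the hyperplane `cl(τ + e)` has `≤ 6` points, so two points of
`X − τ` lie outside it: `two_le_card_partners`), while every such `τ'` has AT MOST TWO partners `τ = A − z`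
(`A := X − τ'` is an independent `4`-set; `f ∈ cl(A − z)` for three points `z` would put `f` in the closure of a single
point — submodularity twice, `card_filter_mem_clF_erase_le_two`; `card_partners_le_two`).  Mathlib's
`sum_card_bipartiteAbove_eq_sum_card_bipartiteBelow` turns the two degree bounds into
**`#tOneOnly ≤ #fIndep`** (`card_tOneOnly_le_card_fIndep`) — the general half of (★)₉ on the simple cosimple core.
-/

open scoped Matroid

namespace PercRepro.Cogirth

open Finset ThmH Skew Shadow Profile

open Classical

variable {α : Type} [DecidableEq α] {N : Matroid α} [N.Finite]

section StarNineSplitB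

/-- **EVERY SECOND-KIND `e`-DEFECT HAS AT LEAST TWO PARTNERS** among the `f`-defects with `τ' + e` independent and
`τ' ∩ τ = ∅`: the hyperplane `cl(τ + e)` has `≤ 6` points, so at least two points `z` of `X − τ` lie outside it. -/
theorem two_le_card_partners (hn : (gr N).card = 9)
    (hcos : ∀ x ∈ gr N, ∀ y ∈ gr N, x ≠ y → rk N (((gr N).erase x).erase y) = 5) {e f : α} (he : e ∈ gr N)
    (hf : f ∈ gr N) (hef : e ≠ f) {τ : Finset α} (hτ : τ ∈ tOneOnly N e f) :
    2 ≤ ((fIndep N e f).filter (fun τ' => Disjoint τ' τ)).card := by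
  have hτ' := hτ
  unfold tOneOnly at hτ'
  rw [mem_filter] at hτ'
  obtain ⟨hτD, _⟩ := hτ'
  obtain ⟨hτX, hτ3, hrkτe, _, _, hK, _⟩ := edefect_facts hn he hf hef hτD
  set X := ((gr N).erase e).erase f with hXdef
  set K := X \ τ with hKdef
  have hXg : X ⊆ gr N := X_subset_gr N e f
  have hτg : τ ⊆ gr N := hτX.trans hXg
  have hτeg : insert e τ ⊆ gr N := insert_subset he hτg
  set H := clF N (insert e τ) with hHdef
  have hHg : H ⊆ gr N := clF_subset_gr _
  have hH6 : H.card ≤ 6 := card_le_six_of_rk_le_four hn hcos hHg (by rw [rk_clF_eq_rk, hrkτe])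
  have hτeH : insert e τ ⊆ H := subset_clF hτeg
  have hcard4 : (insert e τ).card = 4 := by
    rw [card_insert_of_notMem (fun h => (mem_erase.1 (mem_erase.1 (hτX h)).2).1 rfl), hτ3]
  -- `K ∩ H ⊆ H − (τ + e)`, which has at most two points
  have hKH : K ∩ H ⊆ H \ insert e τ := by
    intro a ha
    rw [mem_inter] at ha
    rw [mem_sdiff]
    refine ⟨ha.2, ?_⟩
    rw [mem_insert, not_or]
    exact ⟨(mem_erase.1 (mem_erase.1 (mem_sdiff.1 ha.1).1).2).1, (mem_sdiff.1 ha.1).2⟩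
  have hKH2 : (K ∩ H).card ≤ 2 := by
    have := card_le_card hKH
    rw [card_sdiff_of_subset hτeH, hcard4] at this
    omega
  have hZ : 2 ≤ (K \ H).card := by
    have := card_sdiff_add_card_inter K H
    omega
  -- the injection `z ↦ K − z` from `K − H` into the partners
  refine le_trans hZ (card_le_card_of_injOn (fun z => K.erase z) ?_ ?_)
  · intro z hz
    rw [mem_coe] at hz ⊢
    rw [mem_filter]
    exact partner_mem_fIndep hn he hf hef hτ (mem_sdiff.1 hz).1 (mem_sdiff.1 hz).2
  · intro z₁ hz₁ z₂ hz₂ h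
    rw [mem_coe, mem_sdiff] at hz₁ hz₂
    exact (erase_inj K hz₁.1).1 h

/-- **THREE POINTS CANNOT ALL SPAN `f`**: for an independent `4`-set `A` (`f ∉ A`) in a simple matroid, at most two
`z ∈ A` have `f ∈ cl(A − z)` — submodularity twice puts `f` in the closure of a single point. -/
theorem card_filter_mem_clF_erase_le_two (hsimple : ∀ x ∈ gr N, ∀ y ∈ gr N, x ≠ y → rk N {x, y} = 2) {f : α}
    (hf : f ∈ gr N) {A : Finset α} (hA : A ⊆ gr N) (hfA : f ∉ A) (hcard : A.card = 4) (hrk : rk N A = 4) :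
    (A.filter (fun z => rk N (insert f (A.erase z)) ≤ 3)).card ≤ 2 := by
  by_contra hcon
  rw [not_le, two_lt_card_iff] at hcon
  obtain ⟨z₁, z₂, z₃, h₁, h₂, h₃, h12, h13, h23⟩ := hcon
  rw [mem_filter] at h₁ h₂ h₃
  obtain ⟨hz₁, hr₁⟩ := h₁
  obtain ⟨hz₂, hr₂⟩ := h₂
  obtain ⟨hz₃, hr₃⟩ := h₃
  have hfg : f ∈ gr N := hf
  -- step 1: `f ∈ cl(A − z₁ − z₂)`, i.e. `ρ(f + (A − z₁ − z₂)) ≤ 2`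
  have hsub1 : A ⊆ insert f (A.erase z₁) ∪ insert f (A.erase z₂) := by
    intro a ha
    rw [mem_union, mem_insert, mem_insert, mem_erase, mem_erase]
    by_cases haz : a = z₁
    · exact Or.inr (Or.inr ⟨haz ▸ h12, ha⟩)
    · exact Or.inl (Or.inr ⟨haz, ha⟩)
  have hI1 : insert f ((A.erase z₁).erase z₂) ⊆ insert f (A.erase z₁) ∩ insert f (A.erase z₂) := by
    apply subset_inter
    · exact insert_subset_insert f (erase_subset _ _)
    · exact insert_subset_insert f (by rw [erase_right_comm]; exact erase_subset _ _)
  have hs1 := rk_union_add_rk_le_of_subset_inter (N := N) hI1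
  have hu1 : 4 ≤ rk N (insert f (A.erase z₁) ∪ insert f (A.erase z₂)) := hrk ▸ rk_mono' (M := N) hsub1
  have hr12 : rk N (insert f ((A.erase z₁).erase z₂)) ≤ 2 := by omega
  -- step 2: with `z₃`, `f` lies in the closure of the remaining single point
  have hsub2 : A ⊆ insert f (A.erase z₃) ∪ insert f ((A.erase z₁).erase z₂) := by
    intro a ha
    rw [mem_union, mem_insert, mem_insert, mem_erase, mem_erase, mem_erase]
    by_cases haz : a = z₃
    · exact Or.inr (Or.inr ⟨haz ▸ h23.symm, haz ▸ h13.symm, ha⟩)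
    · exact Or.inl (Or.inr ⟨haz, ha⟩)
  have hI2 : insert f (((A.erase z₁).erase z₂).erase z₃) ⊆
      insert f (A.erase z₃) ∩ insert f ((A.erase z₁).erase z₂) := by
    apply subset_inter
    · exact insert_subset_insert f (fun a ha => mem_erase.2 ⟨(mem_erase.1 ha).1,
        mem_of_mem_erase (mem_of_mem_erase (mem_erase.1 ha).2)⟩)
    · exact insert_subset_insert f (erase_subset _ _)
  have hs2 := rk_union_add_rk_le_of_subset_inter (N := N) hI2
  have hu2 : 4 ≤ rk N (insert f (A.erase z₃) ∪ insert f ((A.erase z₁).erase z₂)) := hrk ▸ rk_mono' (M := N) hsub2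
  have hr123 : rk N (insert f (((A.erase z₁).erase z₂).erase z₃)) ≤ 1 := by omega
  -- the remaining point `w` gives `ρ{f, w} = 2 ≤ 1`
  have hcardw : (((A.erase z₁).erase z₂).erase z₃).card = 1 := by
    rw [card_erase_of_mem (mem_erase.2 ⟨h23.symm, mem_erase.2 ⟨h13.symm, hz₃⟩⟩),
      card_erase_of_mem (mem_erase.2 ⟨h12.symm, hz₂⟩), card_erase_of_mem hz₁, hcard]
  obtain ⟨w, hw⟩ := card_eq_one.1 hcardw
  have hwA : w ∈ A := by
    have : w ∈ ((A.erase z₁).erase z₂).erase z₃ := by rw [hw]; exact mem_singleton_self w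
    exact mem_of_mem_erase (mem_of_mem_erase (mem_of_mem_erase this))
  have hfw : f ≠ w := fun h => hfA (h ▸ hwA)
  have h2 := hsimple f hf w (hA hwA) hfw
  have hle : rk N ({f, w} : Finset α) ≤ rk N (insert f (((A.erase z₁).erase z₂).erase z₃)) := by
    apply rk_mono'
    rw [hw]
  omega

/-- **EVERY `f`-DEFECT WITH `τ' + e` INDEPENDENT HAS AT MOST TWO PARTNERS** among the second-kind `e`-defects: the
partners are `A − z` for `A := X − τ'` (independent) and `z` with `f ∈ cl(A − z)`. -/
theorem card_partners_le_two (hn : (gr N).card = 9) (hsimple : ∀ x ∈ gr N, ∀ y ∈ gr N, x ≠ y → rk N {x, y} = 2)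
    {e f : α} (he : e ∈ gr N) (hf : f ∈ gr N) (hef : e ≠ f) {τ' : Finset α} (hτ' : τ' ∈ fIndep N e f) :
    ((tOneOnly N e f).filter (fun τ => Disjoint τ τ')).card ≤ 2 := by
  have hτ'' := hτ'
  unfold fIndep at hτ''
  rw [mem_filter] at hτ''
  obtain ⟨hτ'D, _⟩ := hτ''
  obtain ⟨hτ'X, hτ'3, _, _, hrkA, hA4, _⟩ := fdefect_facts hn he hf hef hτ'D
  set X := ((gr N).erase e).erase f with hXdef
  set A := X \ τ' with hAdef
  have hXg : X ⊆ gr N := X_subset_gr N e f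
  have hAX : A ⊆ X := sdiff_subset
  have hAg : A ⊆ gr N := hAX.trans hXg
  have hfA : f ∉ A := fun h => (mem_erase.1 (mem_sdiff.1 h).1).1 rfl
  -- every partner is `A − z` for the `z` with `f ∈ cl(A − z)`
  have hsub : (tOneOnly N e f).filter (fun τ => Disjoint τ τ') ⊆
      (A.filter (fun z => rk N (insert f (A.erase z)) ≤ 3)).image (fun z => A.erase z) := by
    intro τ hτ
    rw [mem_filter] at hτ
    obtain ⟨hτT, hdisj⟩ := hτ
    have hτT' := hτT
    unfold tOneOnly at hτT'
    rw [mem_filter] at hτT'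
    obtain ⟨hτD, _⟩ := hτT'
    obtain ⟨hτX, hτ3, _, _, _, _, _⟩ := edefect_facts hn he hf hef hτD
    have hτA : τ ⊆ A := fun a ha => mem_sdiff.2 ⟨hτX ha, fun h => disjoint_left.1 hdisj ha h⟩
    have hcard1 : (A \ τ).card = 1 := by rw [card_sdiff_of_subset hτA, hA4, hτ3]
    obtain ⟨z, hz⟩ := card_eq_one.1 hcard1
    have hzA : z ∈ A \ τ := by rw [hz]; exact mem_singleton_self z
    have hτeq : A.erase z = τ := by
      ext a
      rw [mem_erase]
      constructor
      · rintro ⟨haz, haA⟩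
        by_contra haτ
        have : a ∈ A \ τ := mem_sdiff.2 ⟨haA, haτ⟩
        rw [hz, mem_singleton] at this
        exact haz this
      · intro ha
        exact ⟨fun h => (mem_sdiff.1 hzA).2 (h ▸ ha), hτA ha⟩
    rw [mem_image]
    refine ⟨z, ?_, hτeq⟩
    rw [mem_filter]
    refine ⟨(mem_sdiff.1 hzA).1, ?_⟩
    rw [hτeq]
    exact rk_insert_f_le_three_of_tOneOnly hn he hf hef hτT
  calc ((tOneOnly N e f).filter (fun τ => Disjoint τ τ')).card
      ≤ ((A.filter (fun z => rk N (insert f (A.erase z)) ≤ 3)).image (fun z => A.erase z)).card := card_le_card hsub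
    _ ≤ (A.filter (fun z => rk N (insert f (A.erase z)) ≤ 3)).card := card_image_le
    _ ≤ 2 := card_filter_mem_clF_erase_le_two hsimple hf hAg hfA hA4 hrkA

/-- **THE SECOND-KIND `e`-DEFECTS ARE PAID BY THE `f`-DEFECTS WITH `τ' + e` INDEPENDENT**: `#tOneOnly ≤ #fIndep`, by
the double count over the relation `τ' ∩ τ = ∅` (every `τ` has `≥ 2` partners, every `τ'` has `≤ 2`). -/
theorem card_tOneOnly_le_card_fIndep (hn : (gr N).card = 9)
    (hsimple : ∀ x ∈ gr N, ∀ y ∈ gr N, x ≠ y → rk N {x, y} = 2)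
    (hcos : ∀ x ∈ gr N, ∀ y ∈ gr N, x ≠ y → rk N (((gr N).erase x).erase y) = 5) {e f : α} (he : e ∈ gr N)
    (hf : f ∈ gr N) (hef : e ≠ f) : (tOneOnly N e f).card ≤ (fIndep N e f).card := by
  have hdc := sum_card_bipartiteAbove_eq_sum_card_bipartiteBelow (fun (τ τ' : Finset α) => Disjoint τ τ')
    (s := tOneOnly N e f) (t := fIndep N e f)
  have hlow : (tOneOnly N e f).card • 2 ≤ ∑ τ ∈ tOneOnly N e f, (bipartiteAbove (fun τ τ' => Disjoint τ τ') (fIndep N e f) τ).card := by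
    apply card_nsmul_le_sum
    intro τ hτ
    unfold bipartiteAbove
    have := two_le_card_partners hn hcos he hf hef hτ
    have hcongr : (fIndep N e f).filter (fun τ' => Disjoint τ' τ) = (fIndep N e f).filter (fun τ' => Disjoint τ τ') :=
      filter_congr (fun _ _ => disjoint_comm)
    rw [hcongr] at this
    exact this
  have hup : ∑ τ' ∈ fIndep N e f, (bipartiteBelow (fun τ τ' => Disjoint τ τ') (tOneOnly N e f) τ').card ≤
      (fIndep N e f).card • 2 := by
    apply sum_le_card_nsmul
    intro τ' hτ'
    unfold bipartiteBelow
    exact card_partners_le_two hn hsimple he hf hef hτ'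
  rw [hdc] at hlow
  have := hlow.trans hup
  simp only [smul_eq_mul] at this
  omega

end StarNineSplitB

end PercRepro.Cogirth
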